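import Mathlib.Algebra.MvPolynomial.PDeriv
import Mathlib.Data.ZMod.Basic
import Literature.AlgebraicGeometry.Resolution.BlowupChartRsop
import Summits.ResolutionOfSingularities.ResolutionOfSingularities.Theorems.RadicialJungCleanModelsStubLeibnizObstruction
import HarnessLib

/-!
# Stub `stub_nodalBlowup`, part 1/3: the unit case of the chart computation, and the twist
(crux stmt-ResolutionOfSingularities-15917, `CleanModels`, line `Sketch` rev 7)

Route `ResolutionOfSingularities/RadicialJung`, crux item `CleanModels`, line `Sketch` (rev 7),
stub `stub_nodalBlowup` (nodal points are cured by one point blow-up). This file holds the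
pure-algebra ingredients that do not mention blowing ups:

* `chart_unit_obstruction` — in one chart of the point blow-up of a two-dimensional regular
  local ring `O` of characteristic `p` (ABSTRACT chart data as in `BlowupChartRsop.lean`:
  `ψ : O → A`, `W = c_j/c_i`, `ε : κ[T] ≅ A/(ψ c_i)` with `ε(r̄) = ψ r`, `ε(T) = W`, a prime
  `𝔓 ⊂ A` over `𝔪` and a localization `L = A_𝔓`), at a point `𝔓` of the exceptional curve
  `A/(c_i) ≅ κ[T]` OTHER than `T = 0`, the unit `s = u (cc W + c_i r)^e` (`u, cc` units of `O`,
  `p ∤ e`) satisfies: `s - C^p ∈ 𝔪_L ⇒ s - C^p ∉ 𝔪_L²`. Indeed `s` restricts to `ū c̄c^e T^e` on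
  the exceptional curve, whose `T`-derivative `e ū c̄c^e T^{e-1}` is not in the image of `𝔓`,
  and the Leibniz obstruction `stub_leibnizObstruction` applies to `∂/∂T`.
* `twist_identity`, `loose_transport` — the `p`-th power twist `(c_i^{-q})^p · u f₁^e =
  u f̃^e c_i^r` (`f₁ = c_i² f̃`, `2e = pq + r`) in the function field, read through a square
  "stalk → function field" `F ∘ (O → K) = (L → K') ∘ aL ∘ φ`: loose cleanness of
  `aL(φ u · f̃^e · φ(c_i)^r)` in `L` gives loose cleanness of `F(h^p x)` for `h = c_i^{-q} ≠ 0`.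
* small combinatorics of `Fin 2`.
-/

noncomputable section

set_option linter.dupNamespace false -- mandated namespace of this single-conjunct summit

open IsLocalRing
open Literature.AlgebraicGeometry.Resolution

namespace Summit.ResolutionOfSingularities.ResolutionOfSingularities.Theorems.RadicialJung.CleanModels

universe u

/-! ## Small combinatorics of `Fin 2` -/

/-- The two indices of `Fin 2`. -/
theorem fin_two_eq_or_eq (i j : Fin 2) (hij : j ≠ i) (k : Fin 2) : k = i ∨ k = j := by
  rcases Fin.exists_fin_two.mp ⟨i, rfl⟩ with hi | hi <;>
  rcases Fin.exists_fin_two.mp ⟨j, rfl⟩ with hj | hj <;>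
  rcases Fin.exists_fin_two.mp ⟨k, rfl⟩ with hk | hk <;>
  simp_all

/-- The complement of one index of `Fin 2` is a singleton. -/
theorem natCard_ne_eq_one (i j : Fin 2) (hij : j ≠ i) : Nat.card {k : Fin 2 // k ≠ i} = 1 := by
  rw [Nat.card_eq_one_iff_unique]
  refine ⟨⟨fun a b => Subtype.ext ?_⟩, ⟨⟨j, hij⟩⟩⟩
  rcases fin_two_eq_or_eq i j hij a.1 with ha | ha
  · exact absurd ha a.2
  rcases fin_two_eq_or_eq i j hij b.1 with hb | hb
  · exact absurd hb b.2
  rw [ha, hb]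

/-- The other index of `Fin 2`, with the product of a pair in either order. -/
theorem fin_two_other (jc : Fin 2) : ∃ jo : Fin 2, jo ≠ jc ∧
    ∀ (M : Type u) [CommMonoid M] (c : Fin 2 → M), c jc * c jo = c 0 * c 1 := by
  fin_cases jc
  · exact ⟨1, by decide, fun M _ c => rfl⟩
  · exact ⟨0, by decide, fun M _ c => mul_comm _ _⟩

/-! ## The unit case of the chart computation -/

section UnitCase

/-- **The unit case.** With abstract chart data `(A, ψ, W = ug j, ε, 𝔓, L)` for the chart
`O[c_j/c_i]` of the point blow-up of `(O, 𝔪 = (c_i, c_j))`, `char O = p`: if `W ∉ 𝔓`, `u, cc`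
are units of `O` and `p ∤ e`, then the unit `s = u (cc W + c_i r)^e` of `L` has
`s - C^p ∉ 𝔪_L²` whenever `s - C^p ∈ 𝔪_L`. On the exceptional curve `A/(c_i) ≅ κ[T]`
(`κ = O/𝔪`), `s` becomes `ū c̄c^e T^e`, and `∂/∂T` of it, `e ū c̄c^e T^{e-1}`, avoids the prime
`𝔓̄ ∌ T`; conclude by the Leibniz obstruction (`stub_leibnizObstruction`). -/
theorem chart_unit_obstruction {O : Type u} [CommRing O] [IsLocalRing O] (c : Fin 2 → O)
    (i : Fin 2) {A : Type u} [CommRing A] (L : Type u) [CommRing L] [IsLocalRing L]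
    (ψ : O →+* A) (ug : Fin 2 → A)
    (ε : MvPolynomial {j : Fin 2 // j ≠ i} (O ⧸ Ideal.span (Set.range c)) ≃+*
      A ⧸ Ideal.span {ψ (c i)})
    (hεC : ∀ r : O, ε (MvPolynomial.C (Ideal.Quotient.mk (Ideal.span (Set.range c)) r)) =
      Ideal.Quotient.mk _ (ψ r))
    (hεX : ∀ j : {j : Fin 2 // j ≠ i}, ε (MvPolynomial.X j) = Ideal.Quotient.mk _ (ug j.1))
    (𝔓 : Ideal A) [𝔓.IsPrime] (h𝔓 : 𝔓.comap ψ = maximalIdeal O)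
    [Algebra A L] [IsLocalization.AtPrime L 𝔓] (p : ℕ) (hp : p.Prime) [CharP O p]
    (hc : Ideal.span (Set.range c) = maximalIdeal O) (j : Fin 2) (hij : j ≠ i) (hW : ug j ∉ 𝔓)
    (u cc : O) (hu : IsUnit u) (hcc : IsUnit cc) (e : ℕ) (he : ¬ p ∣ e) (r : A) (c' : L)
    (hc' : algebraMap A L (ψ u * (ψ cc * ug j + ψ (c i) * r) ^ e) - c' ^ p ∈ maximalIdeal L) :
    algebraMap A L (ψ u * (ψ cc * ug j + ψ (c i) * r) ^ e) - c' ^ p ∉ maximalIdeal L ^ 2 := by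
  classical
  -- membership in `𝔓` of elements of `O`
  have hψmem : ∀ r, ψ r ∈ 𝔓 ↔ r ∈ maximalIdeal O := fun r => by
    rw [← h𝔓, Ideal.mem_comap]
  have hci𝔓 : ψ (c i) ∈ 𝔓 := (hψmem _).mpr (hc ▸ Ideal.subset_span ⟨i, rfl⟩)
  have hKle : Ideal.span {ψ (c i)} ≤ 𝔓 := by
    rw [Ideal.span_le, Set.singleton_subset_iff]
    exact hci𝔓
  -- `Φ : A → A/(c_i) ≅ κ[T]`
  let Φ : A →+* MvPolynomial {k : Fin 2 // k ≠ i} (O ⧸ Ideal.span (Set.range c)) :=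
    ε.symm.toRingHom.comp (Ideal.Quotient.mk (Ideal.span {ψ (c i)}))
  have hΦsurj : Function.Surjective Φ :=
    ε.symm.surjective.comp Ideal.Quotient.mk_surjective
  have hΦker : RingHom.ker Φ = Ideal.span {ψ (c i)} := by
    rw [RingHom.ker_equiv_comp, Ideal.mk_ker]
  have hΦapply : ∀ b, ε (Φ b) = Ideal.Quotient.mk (Ideal.span {ψ (c i)}) b := fun b =>
    ε.apply_symm_apply _
  have hΦC : ∀ r : O, Φ (ψ r) = MvPolynomial.C (Ideal.Quotient.mk _ r) := fun r =>
    ε.injective (by rw [hΦapply, hεC])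
  have hΦX : Φ (ug j) = MvPolynomial.X ⟨j, hij⟩ :=
    ε.injective (by rw [hΦapply, hεX])
  have hΦci : Φ (ψ (c i)) = 0 := by
    rw [← RingHom.mem_ker, hΦker]
    exact Ideal.mem_span_singleton_self _
  -- the prime `Q = Φ(𝔓)` of the exceptional curve
  haveI hQ : (𝔓.map Φ).IsPrime :=
    Ideal.map_isPrime_of_surjective hΦsurj (by rw [hΦker]; exact hKle)
  have hQcomap : (𝔓.map Φ).comap Φ = 𝔓 := by
    rw [Ideal.comap_map_of_surjective _ hΦsurj, ← RingHom.ker_eq_comap_bot, hΦker,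
      sup_eq_left.mpr hKle]
  have hmemQ : ∀ b, Φ b ∈ 𝔓.map Φ ↔ b ∈ 𝔓 := fun b => by
    rw [← Ideal.mem_comap, hQcomap]
  -- characteristic `p` on the exceptional curve; `e` is a unit there
  haveI : Nontrivial (O ⧸ Ideal.span (Set.range c)) :=
    Ideal.Quotient.nontrivial_iff.mpr (by rw [hc]; exact (maximalIdeal.isMaximal O).ne_top)
  haveI : CharP (O ⧸ Ideal.span (Set.range c)) p :=
    (CharP.charP_iff_prime_eq_zero hp).mpr (by
      rw [← map_natCast (Ideal.Quotient.mk (Ideal.span (Set.range c))), CharP.cast_eq_zero,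
        map_zero])
  have heunit : IsUnit ((e : ℕ) :
      MvPolynomial {k : Fin 2 // k ≠ i} (O ⧸ Ideal.span (Set.range c))) := by
    have h1 : IsUnit ((e : ℕ) : ZMod p) := by
      rw [ZMod.isUnit_iff_coprime]
      exact ((Nat.Prime.coprime_iff_not_dvd hp).mpr he).symm
    have h2 := h1.map (ZMod.castHom (dvd_refl p)
      (MvPolynomial {k : Fin 2 // k ≠ i} (O ⧸ Ideal.span (Set.range c))))
    rwa [map_natCast] at h2
  have hCu : ∀ r : O, IsUnit r →
      MvPolynomial.C (Ideal.Quotient.mk (Ideal.span (Set.range c)) r) ∉ 𝔓.map Φ :=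
    fun r hr h => hQ.ne_top (Ideal.eq_top_of_isUnit_mem _ h ((hr.map _).map _))
  have hXQ : (MvPolynomial.X ⟨j, hij⟩ :
      MvPolynomial {k : Fin 2 // k ≠ i} (O ⧸ Ideal.span (Set.range c))) ∉ 𝔓.map Φ :=
    fun h => hW ((hmemQ _).mp (hΦX ▸ h))
  -- the derivation `∂/∂T` (as a `ℤ`-derivation) and `∂/∂T (ū c̄c^e T^e) ∉ Q`
  let D : Derivation ℤ (MvPolynomial {k : Fin 2 // k ≠ i} (O ⧸ Ideal.span (Set.range c)))
      (MvPolynomial {k : Fin 2 // k ≠ i} (O ⧸ Ideal.span (Set.range c))) :=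
    Derivation.mk' (MvPolynomial.pderiv ⟨j, hij⟩).toLinearMap.toAddMonoidHom.toIntLinearMap
      (fun a b => by
        change MvPolynomial.pderiv _ (a * b) = _
        rw [(MvPolynomial.pderiv _).leibniz]
        rfl)
  have hDapply : ∀ z, D z = MvPolynomial.pderiv ⟨j, hij⟩ z := fun z => rfl
  have hΦs : Φ (ψ u * (ψ cc * ug j + ψ (c i) * r) ^ e) =
      MvPolynomial.C (Ideal.Quotient.mk _ u) *
        (MvPolynomial.C (Ideal.Quotient.mk _ cc) * MvPolynomial.X ⟨j, hij⟩) ^ e := by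
    rw [map_mul, map_pow, map_add, map_mul, map_mul, hΦC, hΦC, hΦX, hΦci, zero_mul, add_zero]
  have hD : D (Φ (ψ u * (ψ cc * ug j + ψ (c i) * r) ^ e)) ∉ 𝔓.map Φ := by
    rw [hDapply, hΦs, MvPolynomial.pderiv_C_mul, MvPolynomial.pderiv_pow,
      MvPolynomial.pderiv_C_mul, MvPolynomial.pderiv_X_self, mul_one]
    intro hmem
    rcases hQ.mem_or_mem hmem with h | h
    · exact hCu u hu h
    rcases hQ.mem_or_mem h with h | h
    · rcases hQ.mem_or_mem h with h | h
      · exact hQ.ne_top (Ideal.eq_top_of_isUnit_mem _ h heunit)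
      · rcases hQ.mem_or_mem (hQ.mem_of_pow_mem _ h) with h | h
        · exact hCu cc hcc h
        · exact hXQ h
    · exact hCu cc hcc h
  exact stub_leibnizObstruction Φ p hp 𝔓 (𝔓.map Φ) hQcomap D _ hD c' hc'

end UnitCase

/-! ## The twist, and transport to the function fields -/

section Transport

/-- The `p`-th power twist in a field: `(w^{-q})^p · U (w² F)^e = U F^e w^r` when
`2e = pq + r` and `w ≠ 0`. -/
theorem twist_identity {K : Type*} [Field K] (w U F : K) (hw : w ≠ 0) {p q r e : ℕ}
    (hn : 2 * e = p * q + r) : (w⁻¹ ^ q) ^ p * (U * (w ^ 2 * F) ^ e) = U * F ^ e * w ^ r := by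
  have h1 : (w ^ 2 * F) ^ e = (w ^ p) ^ q * w ^ r * F ^ e := by
    rw [mul_pow, ← pow_mul, hn, pow_add, pow_mul]
  have h2 : (w⁻¹ ^ q) ^ p = ((w ^ p) ^ q)⁻¹ := by
    rw [← pow_mul, inv_pow, mul_comm q p, pow_mul]
  have hX : (w ^ p) ^ q ≠ 0 := pow_ne_zero _ (pow_ne_zero _ hw)
  rw [h1, h2]
  calc ((w ^ p) ^ q)⁻¹ * (U * ((w ^ p) ^ q * w ^ r * F ^ e))
      = ((w ^ p) ^ q)⁻¹ * (w ^ p) ^ q * (U * F ^ e * w ^ r) := by ring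
    _ = U * F ^ e * w ^ r := by rw [inv_mul_cancel₀ hX, one_mul]

/-- **The twist and the transport along the stalk-to-function-field square.** Given ring
homomorphisms `φ : O → B`, `aL : B → L`, fields `K ⊇ O`, `K' ⊇ L` and `F : K → K'` with
`F(a) = aL(φ a)` on `O`, if `x = u f₁^e` in `K`, `φ f₁ = φ(cᵢ)² f̃` and
`y = aL(φ u · f̃^e · φ(cᵢ)^{2e mod p})` is loosely clean in `L`, then for
`h = cᵢ^{-⌊2e/p⌋} ∈ K ∖ 0` the rational function `F(h^p x) = y` is loosely clean in `L ⊆ K'`. -/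
theorem loose_transport {O B L K K' : Type*} [CommRing O] [CommRing B] [CommRing L]
    [IsLocalRing L] [Field K] [Field K'] [Algebra O K] [Algebra L K'] (φ : O →+* B)
    (aL : B →+* L) (F : K →+* K')
    (hcompat : ∀ a, F (algebraMap O K a) = algebraMap L K' (aL (φ a)))
    (p e : ℕ) (u f₁ ci : O) (ft : B) (y : L) (x : K)
    (hx : x = algebraMap O K (u * f₁ ^ e)) (hft : φ f₁ = φ ci ^ 2 * ft)
    (hy : y = aL (φ u * ft ^ e * φ ci ^ (2 * e % p))) (hci : algebraMap O K ci ≠ 0)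
    (hloose :
      (∃ (d m : ℕ) (hmd : m ≤ d) (t : Fin d → L) (a : Fin m → ℕ) (u' : L), IsUnit u' ∧
          Ideal.span (Set.range t) = maximalIdeal L ∧ ringKrullDim L = (d : WithBot ℕ∞) ∧
          0 < m ∧ (∀ k, ¬ p ∣ a k) ∧ y = u' * ∏ k : Fin m, t (Fin.castLE hmd k) ^ (a k)) ∨
        (∃ u' : L, IsUnit u' ∧ y = u' ∧ ∀ c' : L, u' - c' ^ p ∉ maximalIdeal L) ∨
        (∃ s c' : L, y = s ∧ s - c' ^ p ∈ maximalIdeal L ∧ s - c' ^ p ∉ maximalIdeal L ^ 2)) :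
    ∃ h : K, h ≠ 0 ∧
      ((∃ (d m : ℕ) (hmd : m ≤ d) (t : Fin d → L) (a : Fin m → ℕ) (u' : L), IsUnit u' ∧
          Ideal.span (Set.range t) = maximalIdeal L ∧ ringKrullDim L = (d : WithBot ℕ∞) ∧
          0 < m ∧ (∀ k, ¬ p ∣ a k) ∧
          F (h ^ p * x) = algebraMap L K' (u' * ∏ k : Fin m, t (Fin.castLE hmd k) ^ (a k))) ∨
        (∃ u' : L, IsUnit u' ∧ F (h ^ p * x) = algebraMap L K' u' ∧
          ∀ c' : L, u' - c' ^ p ∉ maximalIdeal L) ∨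
        (∃ s c' : L, F (h ^ p * x) = algebraMap L K' s ∧
          s - c' ^ p ∈ maximalIdeal L ∧ s - c' ^ p ∉ maximalIdeal L ^ 2)) := by
  refine ⟨(algebraMap O K ci)⁻¹ ^ (2 * e / p), pow_ne_zero _ (inv_ne_zero hci), ?_⟩
  -- `F (h^p x) = y` in `K'`
  have key : F (((algebraMap O K ci)⁻¹ ^ (2 * e / p)) ^ p * x) = algebraMap L K' y := by
    set ψ : O →+* K' := (algebraMap L K').comp (aL.comp φ) with hψdef
    set χ : B →+* K' := (algebraMap L K').comp aL with hχdef
    have hψ : ∀ a, F (algebraMap O K a) = ψ a := hcompat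
    have hψχ : ∀ a, ψ a = χ (φ a) := fun a => rfl
    have h2e : 2 * e = p * (2 * e / p) + 2 * e % p := (Nat.div_add_mod _ _).symm
    have hw : χ (φ ci) ≠ 0 := by
      rw [← hψχ, ← hψ]
      exact (map_ne_zero _).mpr hci
    rw [hx, hy, map_mul, map_pow, map_pow, map_inv₀, hψ, hψ, hψχ, hψχ, map_mul φ, map_pow φ,
      hft]
    change _ = χ _
    simp only [map_mul, map_pow]
    exact twist_identity (χ (φ ci)) (χ (φ u)) (χ ft) hw h2e
  rw [key]
  rcases hloose with ⟨d, m, hmd, t, a, u', hu', h1, h2, h3, h4, h5⟩ | ⟨u', hu', h5, h6⟩ |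
    ⟨s, c', h5, h6, h7⟩
  · exact Or.inl ⟨d, m, hmd, t, a, u', hu', h1, h2, h3, h4, by rw [h5]⟩
  · exact Or.inr (Or.inl ⟨u', hu', by rw [h5], h6⟩)
  · exact Or.inr (Or.inr ⟨s, c', by rw [h5], h6, h7⟩)

end Transport

end Summit.ResolutionOfSingularities.ResolutionOfSingularities.Theorems.RadicialJung.CleanModels

end
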